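import Mathlib
import HarnessLib
import Literature.Analysis.FluidPDE.ZerothLaw
import Literature.Barriers.AnomalousDissipation.GravestModeLaminarAttractorSwept

/-!
# Stub `stub_meanEnergyGlue` of the line `Sketch` (crux stmt-AnomalousDissipation-2937,
# `LimitingAbsorption.UniformRelaxationWitness`): pointwise energy bound ⇒ mean energy bound

Registered signature (proved here, textually; `𝕋² = UnitAddTorus (Fin 2)`,
`E² = EuclideanSpace ℝ (Fin 2)` are the skeleton's local notations, redeclared below):
`stub_meanEnergyGlue : ∀ (v : ℝ → 𝕋² → E²) (E : ℝ),
  (∀ t, 0 ≤ t → ∫⁻ x, ‖v t x‖ₑ ^ 2 ≤ ENNReal.ofReal E) → meanEnergy v ≤ max E 0`.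

The bookkeeping step `pointwise ⇒ mean` of the composition `UniformRelaxationWitness_of`: a bound
`∫⁻ ‖v t‖ₑ² ≤ ofReal E` for every `t ≥ 0` bounds each Bochner slice `∫ ‖v t x‖² dx` by
`(ofReal E).toReal = max E 0` (via `‖∫ f‖ ≤ (∫⁻ ofReal ‖f‖).toReal`, no measurability case split
needed: a non-integrable slice has Bochner integral `0 ≤ max E 0`), and a pointwise bound on
`(0, ∞)` bounds the mean energy `meanEnergy v = limsup_T T⁻¹ ∫₀ᵀ ∫ ‖v‖²` by the in-tree
`Literature.Barriers.AnomalousDissipation.meanEnergy_le_of_forall_le`. The `max … 0` absorbs the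
degenerate case `E < 0` (where the hypothesis forces `v t = 0` a.e.). Pure proof file (no
definitions).
-/

-- `Summit.<Summit>.<Problem>` is the tree's mandated summit-side namespace (CONVENTIONS §2); for this
-- single-conjunct summit the two coincide, so the duplicate is deliberate.
set_option linter.dupNamespace false

noncomputable section

open MeasureTheory
open scoped ENNReal

namespace Summit.AnomalousDissipation.AnomalousDissipation.Theorems

open Literature.Analysis.FluidPDE

/-- The flat two-torus (local notation, as in the registered skeleton). -/
local notation "𝕋²" => UnitAddTorus (Fin 2)
/-- Planar velocity values (local notation, as in the registered skeleton). -/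
local notation "E²" => EuclideanSpace ℝ (Fin 2)

/-- **Slice bound.** If `∫⁻ ‖w x‖ₑ² ≤ ofReal E` then the Bochner integral `∫ ‖w x‖² dx` is at most
`max E 0` — whether or not the slice is integrable (`‖∫ f‖ ≤ (∫⁻ ofReal ‖f‖).toReal` holds
unconditionally, and `(ofReal E).toReal = max E 0`). [folklore] -/
theorem integral_norm_sq_le_max_of_lintegral_enorm_sq_le {w : 𝕋² → E²} {E : ℝ}
    (h : ∫⁻ x, ‖w x‖ₑ ^ 2 ≤ ENNReal.ofReal E) : ∫ x, ‖w x‖ ^ 2 ≤ max E 0 :=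
  calc ∫ x, ‖w x‖ ^ 2 ≤ ‖∫ x, ‖w x‖ ^ 2‖ := Real.le_norm_self _
    _ ≤ (∫⁻ x, ENNReal.ofReal ‖‖w x‖ ^ 2‖).toReal := norm_integral_le_lintegral_norm _
    _ ≤ (ENNReal.ofReal E).toReal := by
      refine ENNReal.toReal_mono ENNReal.ofReal_ne_top (le_trans (lintegral_mono fun x => ?_) h)
      rw [norm_pow, norm_norm, ENNReal.ofReal_pow (norm_nonneg _), ofReal_norm]
    _ = max E 0 := ENNReal.toReal_ofReal'

/-- **The registered stub `stub_meanEnergyGlue`**: a pointwise bound `∫⁻ ‖v t x‖ₑ² ≤ ofReal E`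
on `t ≥ 0` bounds the mean energy `⟨‖v‖₂²⟩ = limsup` of Cesàro means of `t ↦ ∫ ‖v t x‖² dx` by
`max E 0` (slice bound `integral_norm_sq_le_max_of_lintegral_enorm_sq_le` on `t > 0`, then
`Literature.Barriers.AnomalousDissipation.meanEnergy_le_of_forall_le`). [folklore] -/
theorem stub_meanEnergyGlue :
    ∀ (v : ℝ → 𝕋² → E²) (E : ℝ), (∀ t, 0 ≤ t → ∫⁻ x, ‖v t x‖ₑ ^ 2 ≤ ENNReal.ofReal E) →
      meanEnergy v ≤ max E 0 :=
  fun _ _ hE => Literature.Barriers.AnomalousDissipation.meanEnergy_le_of_forall_le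
    fun t ht => integral_norm_sq_le_max_of_lintegral_enorm_sq_le (hE t ht.le)

end Summit.AnomalousDissipation.AnomalousDissipation.Theorems

end
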